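import Literature.Analysis.FluidPDE.PeriodicLerayLimitWeakForm
import HarnessLib

/-!
# [BT1] proof of Theorem 2.4, the limit `ε → 0`, VIII: the local energy inequality (2.4) in the
  limit

Analysis/FluidPDE proof file (theorems only, no new definitions, no named facts), eighth part of
the discharge of the named fact `Literature.Analysis.FluidPDE.bradshawTsai2017_thm_2_4_limit`
(`PeriodicLerayExistence.lean`; Bradshaw–Tsai, Ann. Henri Poincaré 18 (2017) =
arXiv:1510.07504 [BT1], §2, proof of Thm 2.4 with Def. 2.3/(2.4)): "The suitability of `u`
follows as in [CKN]". Along `T`-periodic weak solutions `(U_k, p_k, ∇U_k)` of the mollified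
perturbed Leray systems at scales `ε_k → 0⁺` (local energy inequality (iv) of
`IsMollifiedPeriodicWeakSolution.weakForm`), with `U_k → U` in `L²` and `L³` of the cylinders,
`η_{ε_k} * U_k → U` in `L³` of the cylinders, `p_k ⇀ p` weakly against `L^{5/2}` on the cylinders
and `∇U_k ⇀ ∇U` weakly in `L²` of the slabs, the right-hand sides of (iv) converge (cubic terms by
`L^{3/2} × L³`, the pressure term weak × strong, the commutator term
`⟪DW(U_k − η_{ε_k} * U_k), u_k⟫ψ → 0`), the kinetic part of the left-hand side converges and the
dissipation `∫ |∇U_k + ∇W|² ψ` is weakly lower semicontinuous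
(`lintegral_frobeniusNormSq_mul_le_of_tendsto`, Brezis Prop. 3.5 (iii)); hence the limit
`u = U + W`, `∇u = ∇U + ∇W`, `p` satisfies the local energy inequality (2.4) of
`IsSuitablePeriodicWeakSolution.weakForm` (iv) (`localEnergy_limit`).

## References

* Z. Bradshaw, T.-P. Tsai, Ann. Henri Poincaré 18 (2017) 1095–1119 = arXiv:1510.07504, §2,
  Def. 2.3 and proof of Thm 2.4 [BradshawTsai2017AHP].
* L. Caffarelli, R. Kohn, L. Nirenberg, Comm. Pure Appl. Math. 35 (1982), §2 and Appendix
  [CaffarelliKohnNirenberg1982].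
* H. Brezis, *Functional Analysis* (2011), Prop. 3.5 (iii) [Brezis2011].
-/

noncomputable section

open MeasureTheory TopologicalSpace Set Function Filter Metric Bornology
open scoped NNReal ENNReal Topology InnerProductSpace RealInnerProductSpace Laplacian

namespace Literature.Analysis.FluidPDE

namespace BradshawTsai2017

/-! ### `L^{3/2}` convergence of squares and quadratic pairings -/

section Squares

variable {X : Type*} [MeasurableSpace X] {μ : Measure X}
variable {E : Type*} [NormedAddCommGroup E] [InnerProductSpace ℝ E]

omit [InnerProductSpace ℝ E] in
/-- **`‖fₖ‖² → ‖g‖²` in `L^{3/2}` when `fₖ → g` in `L³`** (`‖fₖ‖² − ‖g‖² = (‖fₖ‖ − ‖g‖)(‖fₖ‖ + ‖g‖)`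
and Hölder `3 · 3 → 3/2`). [folklore] -/
theorem tendsto_eLpNorm_norm_sq_sub [NormedSpace ℝ E] {f : ℕ → X → E} {g : X → E}
    (hf : ∀ k, AEStronglyMeasurable (f k) μ) (hg : MemLp g 3 μ)
    (hlim : Tendsto (fun k => eLpNorm (f k - g) 3 μ) atTop (𝓝 0)) :
    Tendsto (fun k => eLpNorm ((fun x => ‖f k x‖ ^ 2) - fun x => ‖g x‖ ^ 2) (3 / 2) μ) atTop (𝓝 0) := by
  have h3 : (1 : ℝ≥0∞) ≤ 3 := by norm_num
  have hbd : ∀ k, eLpNorm ((fun x => ‖f k x‖ ^ 2) - fun x => ‖g x‖ ^ 2) (3 / 2) μ ≤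
      eLpNorm (f k - g) 3 μ * (eLpNorm (f k - g) 3 μ + 2 * eLpNorm g 3 μ) := by
    intro k
    have e : ((fun x => ‖f k x‖ ^ 2) - fun x => ‖g x‖ ^ 2) =
        fun x => (‖f k x‖ - ‖g x‖) * (‖f k x‖ + ‖g x‖) := by
      funext x; simp only [Pi.sub_apply]; ring
    rw [e]
    refine (FunctionSpaces.eLpNorm_mul_threeHalves_le ((hf k).norm.sub hg.1.norm)
      ((hf k).norm.add hg.1.norm)).trans ?_
    gcongr
    · refine (eLpNorm_mono fun x => ?_)
      rw [Real.norm_eq_abs]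
      exact abs_norm_sub_norm_le (f k x) (g x)
    · calc eLpNorm (fun x => ‖f k x‖ + ‖g x‖) 3 μ
          ≤ eLpNorm (fun x => ‖f k x‖) 3 μ + eLpNorm (fun x => ‖g x‖) 3 μ :=
            eLpNorm_add_le (hf k).norm hg.1.norm h3
        _ = eLpNorm (f k) 3 μ + eLpNorm g 3 μ := by rw [eLpNorm_norm, eLpNorm_norm]
        _ ≤ (eLpNorm (f k - g) 3 μ + eLpNorm g 3 μ) + eLpNorm g 3 μ := by
            gcongr
            have h := eLpNorm_add_le ((hf k).sub hg.1) hg.1 h3 (μ := μ)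
            simpa using h
        _ = eLpNorm (f k - g) 3 μ + 2 * eLpNorm g 3 μ := by ring
  have hG2 : 2 * eLpNorm g 3 μ ≠ ⊤ := ENNReal.mul_ne_top ENNReal.ofNat_ne_top hg.2.ne
  have h1 : Tendsto (fun k => eLpNorm (f k - g) 3 μ + 2 * eLpNorm g 3 μ) atTop
      (𝓝 (0 + 2 * eLpNorm g 3 μ)) := hlim.add tendsto_const_nhds
  have h2 := ENNReal.Tendsto.mul hlim (Or.inr (by simpa using hG2)) h1 (Or.inr ENNReal.zero_ne_top)
  rw [zero_mul] at h2
  exact tendsto_of_tendsto_of_tendsto_of_le_of_le tendsto_const_nhds h2 (fun k => zero_le) hbd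

/-- **Weighted kinetic energies pass to `L²` limits**: `∫ ‖fₖ‖² w → ∫ ‖g‖² w` for `fₖ → g` in
`L²(μ)` (finite measure) and a bounded measurable scalar weight `w`
(`‖f‖² w = ⟪f, (w • id) f⟫`). [folklore] -/
theorem tendsto_integral_norm_sq_mul [IsFiniteMeasure μ] {f : ℕ → X → E} {g : X → E}
    (hf : ∀ k, MemLp (f k) 2 μ) (hg : MemLp g 2 μ)
    (hlim : Tendsto (fun k => eLpNorm (f k - g) 2 μ) atTop (𝓝 0)) {w : X → ℝ}
    (hw : AEStronglyMeasurable w μ) {C : ℝ} (hC0 : 0 ≤ C) (hC : ∀ x, ‖w x‖ ≤ C) :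
    Tendsto (fun k => ∫ x, ‖f k x‖ ^ 2 * w x ∂μ) atTop (𝓝 (∫ x, ‖g x‖ ^ 2 * w x ∂μ)) := by
  set L : X → E →L[ℝ] E := fun x => w x • ContinuousLinearMap.id ℝ E with hL
  have hLm : AEStronglyMeasurable L μ := hw.smul aestronglyMeasurable_const
  have hLC : ∀ x, ‖L x‖ ≤ C := fun x => by
    rw [hL]
    refine (norm_smul_le (w x) (ContinuousLinearMap.id ℝ E)).trans ?_
    calc ‖w x‖ * ‖ContinuousLinearMap.id ℝ E‖ ≤ C * 1 :=
          mul_le_mul (hC x) ContinuousLinearMap.norm_id_le (norm_nonneg _) hC0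
      _ = C := mul_one C
  have h := tendsto_integral_inner_clm_apply₂ (μ := μ) (f := f) (f₀ := g) (g := f) (g₀ := g) (L := L)
    hf hg hf hg hlim hlim hLm hC0 hLC
  have e : ∀ (v : X → E) (x : X), ⟪v x, L x (v x)⟫ = ‖v x‖ ^ 2 * w x := fun v x => by
    simp only [hL, _root_.smul_apply, ContinuousLinearMap.id_apply, real_inner_smul_right,
      real_inner_self_eq_norm_sq, mul_comm (w x)]
  simp only [e] at h
  exact h

end Squares

/-! ### Exponent bookkeeping -/

section Exponents

variable {X : Type*} [MeasurableSpace X] {μ : Measure X} {F : Type*} [NormedAddCommGroup F]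

/-- From `∫⁻ ‖f‖ₑ^{10/3} ≤ M < ∞` on a finite measure space to `f ∈ L³`. [folklore] -/
theorem memLp_three_of_lintegral_tenThirds_le [IsFiniteMeasure μ] {f : X → F} (hfm : AEStronglyMeasurable f μ)
    {M : ℝ≥0∞} (hM : M < ∞) (h : ∫⁻ x, ‖f x‖ₑ ^ (10 / 3 : ℝ) ∂μ ≤ M) : MemLp f 3 μ := by
  have hp0 : (10 / 3 : ℝ≥0∞) ≠ 0 := by simp
  have hpt : (10 / 3 : ℝ≥0∞) ≠ ⊤ := ENNReal.div_ne_top (by simp) (by simp)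
  have htr : (10 / 3 : ℝ≥0∞).toReal = 10 / 3 := by
    rw [ENNReal.toReal_div]; norm_num
  have h103 : MemLp f (10 / 3 : ℝ≥0∞) μ := by
    refine ⟨hfm, ?_⟩
    rw [eLpNorm_lt_top_iff_lintegral_rpow_enorm_lt_top hp0 hpt, htr]
    exact h.trans_lt hM
  refine h103.mono_exponent ?_
  rw [ENNReal.le_div_iff_mul_le (Or.inl (by norm_num)) (Or.inl (by simp))]
  norm_num

/-- `‖f‖_{L³} → 0` from `∫⁻ ‖f‖ₑ³ → 0`. [folklore] -/
theorem tendsto_eLpNorm_three_of_tendsto_lintegral {f : ℕ → X → F}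
    (h : Tendsto (fun k => ∫⁻ x, ‖f k x‖ₑ ^ (3 : ℝ) ∂μ) atTop (𝓝 0)) :
    Tendsto (fun k => eLpNorm (f k) 3 μ) atTop (𝓝 0) := by
  have h1 := ((ENNReal.continuous_rpow_const (y := (1 / 3 : ℝ))).tendsto 0).comp h
  rw [ENNReal.zero_rpow_of_pos (by norm_num)] at h1
  refine h1.congr fun k => ?_
  simp only [Function.comp_apply, eLpNorm_three_eq_rpow]

/-- `(5/2 : ℝ≥0∞) ≤ 3`. [folklore] -/
theorem fiveHalves_le_three : (5 / 2 : ℝ≥0∞) ≤ 3 := by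
  refine ENNReal.div_le_of_le_mul ?_
  norm_num

end Exponents

/-! ### The local energy inequality in the limit -/

section LocalEnergyLimit

set_option maxHeartbeats 1600000 in
/-- **The local energy inequality (2.4) passes to the limit** ([BT1], proof of Thm 2.4: "The
suitability of `u` follows as in [CKN]"). Along `T`-periodic weak solutions `(U_k, p_k)` with
weak gradients `G_k = ∇U_k` of the mollified perturbed Leray systems at scales `ε_k > 0` around
the `C¹` `T`-periodic profile `W` (local energy inequality (iv) of
`IsMollifiedPeriodicWeakSolution.weakForm`), with `U_k → U` in `L²` and `L³` of the cylinders
and `L^{10/3}`-bounded there, `η_{ε_k} * U_k → U` in `L³` of the cylinders, `p_k ⇀ p` weakly on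
the cylinders and `∇U_k ⇀ ∇U` weakly in `L²` of the slabs, the limit `u = U + W`,
`∇u = ∇U + ∇W`, `p` satisfies (2.4): for `0 ≤ ψ ∈ C_c^∞(ℝ⁴)`,
`∫∫ (|u|²/2 + |∇u|²) ψ ≤ ∫∫ |u|²/2 (∂ₛψ + Δψ) + |u|²/2 (u − y)·∇ψ + p u·∇ψ` — the right-hand sides
converge, the kinetic parts of the left-hand sides converge, the commutator term vanishes in the
limit, and the dissipation is weakly lower semicontinuous. [cite: BradshawTsai2017AHP, proof of Thm 2.4 with Def. 2.3 (2.4)] -/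
theorem localEnergy_limit {T : ℝ} (hT : 0 < T)
    {W : ℝ → EuclideanSpace ℝ (Fin 3) → EuclideanSpace ℝ (Fin 3)} (hW : ContDiff ℝ 1 (uncurry W))
    {η : EuclideanSpace ℝ (Fin 3) → ℝ} (hη : IsMollifyingKernel η) {C : ℝ≥0} {ε : ℕ → ℝ} (hε : ∀ k, 0 < ε k)
    {U : ℕ → ℝ → EuclideanSpace ℝ (Fin 3) → EuclideanSpace ℝ (Fin 3)} {p : ℕ → ℝ → EuclideanSpace ℝ (Fin 3) → ℝ}
    (hsol : ∀ k, IsMollifiedPeriodicWeakSolution T W η (ε k) C (U k) (p k))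
    {G : ℕ → ℝ → EuclideanSpace ℝ (Fin 3) → EuclideanSpace ℝ (Fin 3) →L[ℝ] EuclideanSpace ℝ (Fin 3)}
    (hGg : ∀ k, HasWeakSpatialGradientOn (⊤ : Opens (ℝ × EuclideanSpace ℝ (Fin 3))) (U k) (G k))
    (hGb : ∀ k, ∫⁻ z in Ioo 0 T ×ˢ (univ : Set (EuclideanSpace ℝ (Fin 3))),
      ENNReal.ofReal (frobeniusNormSq (G k z.1 z.2)) ≤ C)
    (hGiv : ∀ k (ψ : ℝ → EuclideanSpace ℝ (Fin 3) → ℝ), IsSpaceTimeTestOn (⊤ : Opens (ℝ × EuclideanSpace ℝ (Fin 3))) ψ →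
      (∀ s y, 0 ≤ ψ s y) →
      ∫ s, ∫ y, (‖U k s y + W s y‖ ^ 2 / 2 + frobeniusNormSq (G k s y + fderiv ℝ (W s) y)) * ψ s y ≤
        ∫ s, ∫ y, (‖U k s y + W s y‖ ^ 2 / 2 * (timeDeriv ψ s y + Δ (ψ s) y) +
          (‖U k s y + W s y‖ ^ 2 / 2 * ⟪W s y + mollify η (ε k) (U k) s y - y, gradient (ψ s) y⟫ +
            p k s y * ⟪U k s y + W s y, gradient (ψ s) y⟫) -
          ⟪fderiv ℝ (W s) y (U k s y - mollify η (ε k) (U k) s y), U k s y + W s y⟫ * ψ s y))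
    {Ul : ℝ → EuclideanSpace ℝ (Fin 3) → EuclideanSpace ℝ (Fin 3)}
    (hUlm : AEStronglyMeasurable (uncurry Ul) (volume : Measure (ℝ × EuclideanSpace ℝ (Fin 3))))
    (hconv : ∀ n : ℕ, Tendsto (fun k => ∫⁻ z in Ioo (-((n : ℝ) + 1)) ((n : ℝ) + 1) ×ˢ
        ball (0 : EuclideanSpace ℝ (Fin 3)) (n + 1), ‖U k z.1 z.2 - Ul z.1 z.2‖ₑ ^ 2) atTop (𝓝 0))
    (hconv3 : ∀ n : ℕ, Tendsto (fun k => ∫⁻ z in Ioo (-((n : ℝ) + 1)) ((n : ℝ) + 1) ×ˢ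
        ball (0 : EuclideanSpace ℝ (Fin 3)) (n + 1), ‖U k z.1 z.2 - Ul z.1 z.2‖ₑ ^ (3 : ℝ)) atTop (𝓝 0))
    (hM : ∀ n : ℕ, ∃ M : ℝ≥0∞, M < ∞ ∧
        (∀ k, ∫⁻ z in Ioo (-((n : ℝ) + 1)) ((n : ℝ) + 1) ×ˢ ball (0 : EuclideanSpace ℝ (Fin 3)) (n + 1),
          ‖U k z.1 z.2‖ₑ ^ (10 / 3 : ℝ) ≤ M) ∧
        ∫⁻ z in Ioo (-((n : ℝ) + 1)) ((n : ℝ) + 1) ×ˢ ball (0 : EuclideanSpace ℝ (Fin 3)) (n + 1),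
          ‖Ul z.1 z.2‖ₑ ^ (10 / 3 : ℝ) ≤ M)
    (hmoll : ∀ a b R : ℝ, Tendsto (fun k => eLpNorm (fun z : ℝ × EuclideanSpace ℝ (Fin 3) =>
        mollify η (ε k) (U k) z.1 z.2 - Ul z.1 z.2) 3
        (volume.restrict (Ioo a b ×ˢ ball (0 : EuclideanSpace ℝ (Fin 3)) R))) atTop (𝓝 0))
    {pl : ℝ → EuclideanSpace ℝ (Fin 3) → ℝ}
    (hplm : AEStronglyMeasurable (uncurry pl) (volume : Measure (ℝ × EuclideanSpace ℝ (Fin 3))))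
    (hpl53 : ∀ a b : ℝ, ∫⁻ z in Ioo a b ×ˢ (univ : Set (EuclideanSpace ℝ (Fin 3))), ‖pl z.1 z.2‖ₑ ^ (5 / 3 : ℝ) < ∞)
    (hpw : ∀ (a b R : ℝ) (h : ℝ × EuclideanSpace ℝ (Fin 3) → ℝ),
      MemLp h (5 / 2 : ℝ≥0∞) (volume.restrict (Ioo a b ×ˢ ball (0 : EuclideanSpace ℝ (Fin 3)) R)) →
      Tendsto (fun k => ∫ z in Ioo a b ×ˢ ball (0 : EuclideanSpace ℝ (Fin 3)) R, p k z.1 z.2 * h z) atTop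
        (𝓝 (∫ z in Ioo a b ×ˢ ball (0 : EuclideanSpace ℝ (Fin 3)) R, pl z.1 z.2 * h z)))
    {Gu : ℝ → EuclideanSpace ℝ (Fin 3) → EuclideanSpace ℝ (Fin 3) →L[ℝ] EuclideanSpace ℝ (Fin 3)}
    (hGu : HasWeakSpatialGradientOn (⊤ : Opens (ℝ × EuclideanSpace ℝ (Fin 3))) Ul Gu)
    (hGub : ∀ m : ℕ, ∫⁻ z in Ioo (-((m : ℝ) + 1)) ((m : ℝ) + 1) ×ˢ (univ : Set (EuclideanSpace ℝ (Fin 3))),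
      ENNReal.ofReal (frobeniusNormSq (Gu z.1 z.2)) < ∞)
    (hGw : ∀ (m : ℕ) (a : EuclideanSpace ℝ (Fin 3)) (h : ℝ × EuclideanSpace ℝ (Fin 3) → EuclideanSpace ℝ (Fin 3)),
      MemLp h 2 (volume.restrict (Ioo (-((m : ℝ) + 1)) ((m : ℝ) + 1) ×ˢ (univ : Set (EuclideanSpace ℝ (Fin 3))))) →
      Tendsto (fun k => ∫ z in Ioo (-((m : ℝ) + 1)) ((m : ℝ) + 1) ×ˢ (univ : Set (EuclideanSpace ℝ (Fin 3))),
          ⟪G k z.1 z.2 a, h z⟫) atTop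
        (𝓝 (∫ z in Ioo (-((m : ℝ) + 1)) ((m : ℝ) + 1) ×ˢ (univ : Set (EuclideanSpace ℝ (Fin 3))), ⟪Gu z.1 z.2 a, h z⟫)))
    (ψ : ℝ → EuclideanSpace ℝ (Fin 3) → ℝ) (hψ : IsSpaceTimeTestOn (⊤ : Opens (ℝ × EuclideanSpace ℝ (Fin 3))) ψ)
    (hψ0 : ∀ s y, 0 ≤ ψ s y) :
    ∫ s, ∫ y, (‖Ul s y + W s y‖ ^ 2 / 2 + frobeniusNormSq (Gu s y + fderiv ℝ (W s) y)) * ψ s y ≤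
      ∫ s, ∫ y, (‖Ul s y + W s y‖ ^ 2 / 2 * (timeDeriv ψ s y + Δ (ψ s) y) +
        (‖Ul s y + W s y‖ ^ 2 / 2 * ⟪Ul s y + W s y - y, gradient (ψ s) y⟫ +
          pl s y * ⟪Ul s y + W s y, gradient (ψ s) y⟫)) := by
  have hHT := FunctionSpaces.holderTriple_threeHalves_three
  have happ : Continuous (uncurry fun (L : EuclideanSpace ℝ (Fin 3) →L[ℝ] EuclideanSpace ℝ (Fin 3)) (v : EuclideanSpace ℝ (Fin 3)) => L v) :=
    isBoundedBilinearMap_apply.continuous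
  have h13 : (1 : ℝ≥0∞) ≤ 3 := by norm_num
  have h23 : (2 : ℝ≥0∞) ≤ 3 := by norm_num
  have h132 : (1 : ℝ≥0∞) ≤ 3 / 2 := FunctionSpaces.ennreal_one_le_three_halves
  -- ## the cylinder carrying `ψ`
  obtain ⟨n, hn⟩ := exists_subset_cylinder_of_isCompact hψ.hasCompactSupport
  set a : ℝ := -((n : ℝ) + 1) with ha
  set b : ℝ := (n : ℝ) + 1 with hb
  set R : ℝ := (n : ℝ) + 1 with hR
  set S : Set (ℝ × EuclideanSpace ℝ (Fin 3)) := Ioo a b ×ˢ ball (0 : EuclideanSpace ℝ (Fin 3)) R with hS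
  have hSm : MeasurableSet S := measurableSet_Ioo.prod measurableSet_ball
  haveI hfinQ : IsFiniteMeasure (volume.restrict S) :=
    NSCylinder.isFiniteMeasure_restrict (Ω := ⟨ball (0 : EuclideanSpace ℝ (Fin 3)) R, isOpen_ball⟩) isBounded_ball a b
  set μQ : Measure (ℝ × EuclideanSpace ℝ (Fin 3)) := volume.restrict S with hμQ
  have hsuppS : tsupport (uncurry ψ) ⊆ S := hn
  have hSslab : S ⊆ Ioo (-((n : ℝ) + 1)) ((n : ℝ) + 1) ×ˢ (univ : Set (EuclideanSpace ℝ (Fin 3))) :=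
    prod_mono Subset.rfl (subset_univ _)
  have hR0 : 0 < R := by rw [hR]; positivity
  -- ## the weights
  obtain ⟨Cψ, hC0, hψC, htC, hgC, hΔC⟩ := hψ.exists_scalar_weights_bound
  have hψm : AEStronglyMeasurable (fun z : ℝ × EuclideanSpace ℝ (Fin 3) => ψ z.1 z.2) μQ :=
    hψ.contDiff.continuous.aestronglyMeasurable.restrict
  have htm : AEStronglyMeasurable (fun z : ℝ × EuclideanSpace ℝ (Fin 3) => timeDeriv ψ z.1 z.2) μQ :=
    hψ.continuous_timeDeriv.aestronglyMeasurable.restrict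
  have hΔm : AEStronglyMeasurable (fun z : ℝ × EuclideanSpace ℝ (Fin 3) => Δ (ψ z.1) z.2) μQ :=
    hψ.continuous_laplacian_slice.aestronglyMeasurable.restrict
  have hgm : AEStronglyMeasurable (fun z : ℝ × EuclideanSpace ℝ (Fin 3) => gradient (ψ z.1) z.2) μQ :=
    hψ.continuous_slice_gradient.aestronglyMeasurable.restrict
  -- ## the profile on the cylinder and the truncated slice derivative
  obtain ⟨M, hM0, hMW, -⟩ := exists_profile_bound hW a b (0 : EuclideanSpace ℝ (Fin 3)) R
  have hWc : Continuous (uncurry W) := hW.continuous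
  have cW : Continuous fun z : ℝ × EuclideanSpace ℝ (Fin 3) => W z.1 z.2 := hWc
  have cDW : Continuous fun z : ℝ × EuclideanSpace ℝ (Fin 3) => fderiv ℝ (W z.1) z.2 := continuous_fderiv_slice_of_contDiff hW
  obtain ⟨M₂, hM₂⟩ := ((isCompact_Icc (a := a) (b := b)).prod
    (isCompact_closedBall (0 : EuclideanSpace ℝ (Fin 3)) R)).exists_bound_of_continuousOn cDW.continuousOn
  set MD : ℝ := max M₂ 0 with hMD
  have hMD0 : 0 ≤ MD := le_max_right _ _
  have hMDW : ∀ s ∈ Icc a b, ∀ y ∈ closedBall (0 : EuclideanSpace ℝ (Fin 3)) R, ‖fderiv ℝ (W s) y‖ ≤ MD :=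
    fun s hs y hy => (hM₂ (s, y) ⟨hs, hy⟩).trans (le_max_left _ _)
  have hWm : AEStronglyMeasurable (fun z : ℝ × EuclideanSpace ℝ (Fin 3) => W z.1 z.2) μQ := cW.aestronglyMeasurable.restrict
  have hWbd : ∀ᵐ z ∂μQ, ‖W z.1 z.2‖ ≤ M := by
    filter_upwards [ae_restrict_mem hSm] with z hz
    exact hMW z.1 (Ioo_subset_Icc_self hz.1) z.2 (ball_subset_closedBall hz.2)
  have hWmem3 : MemLp (fun z : ℝ × EuclideanSpace ℝ (Fin 3) => W z.1 z.2) 3 μQ := (memLp_top_of_bound hWm M hWbd).mono_exponent le_top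
  have hWmem : MemLp (fun z : ℝ × EuclideanSpace ℝ (Fin 3) => W z.1 z.2) 2 μQ := hWmem3.mono_exponent h23
  set L : ℝ × EuclideanSpace ℝ (Fin 3) → EuclideanSpace ℝ (Fin 3) →L[ℝ] EuclideanSpace ℝ (Fin 3) :=
    S.indicator fun z => fderiv ℝ (W z.1) z.2 with hL
  have hLm : AEStronglyMeasurable L μQ := (cDW.aestronglyMeasurable.indicator hSm).restrict
  have hLM : ∀ z, ‖L z‖ ≤ MD := by
    intro z
    by_cases hz : z ∈ S
    · rw [hL, indicator_of_mem hz]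
      exact hMDW z.1 (Ioo_subset_Icc_self hz.1) z.2 (ball_subset_closedBall hz.2)
    · rw [hL, indicator_of_notMem hz, norm_zero]; exact hMD0
  have hLae : ∀ᵐ z ∂μQ, L z = fderiv ℝ (W z.1) z.2 := by
    filter_upwards [ae_restrict_mem hSm] with z hz
    rw [hL, indicator_of_mem hz]
  -- ## classes and convergences of the velocities on the cylinder
  have hUm : ∀ k, AEStronglyMeasurable (uncurry (U k)) (volume : Measure (ℝ × EuclideanSpace ℝ (Fin 3))) :=
    fun k => (hsol k).aestronglyMeasurable_velocity
  obtain ⟨Mn, hMn, hUkM, hUlM⟩ := hM n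
  have hU3 : ∀ k, MemLp (fun z : ℝ × EuclideanSpace ℝ (Fin 3) => U k z.1 z.2) 3 μQ := fun k =>
    memLp_three_of_lintegral_tenThirds_le (hUm k).restrict hMn (hUkM k)
  have hUl3 : MemLp (fun z : ℝ × EuclideanSpace ℝ (Fin 3) => Ul z.1 z.2) 3 μQ :=
    memLp_three_of_lintegral_tenThirds_le hUlm.restrict hMn hUlM
  have hu3 : ∀ k, MemLp (fun z : ℝ × EuclideanSpace ℝ (Fin 3) => U k z.1 z.2 + W z.1 z.2) 3 μQ := fun k => (hU3 k).add hWmem3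
  have hul3 : MemLp (fun z : ℝ × EuclideanSpace ℝ (Fin 3) => Ul z.1 z.2 + W z.1 z.2) 3 μQ := hUl3.add hWmem3
  have hU2 : ∀ k, MemLp (fun z : ℝ × EuclideanSpace ℝ (Fin 3) => U k z.1 z.2) 2 μQ := fun k => (hU3 k).mono_exponent h23
  have hUl2 : MemLp (fun z : ℝ × EuclideanSpace ℝ (Fin 3) => Ul z.1 z.2) 2 μQ := hUl3.mono_exponent h23
  have hu2 : ∀ k, MemLp (fun z : ℝ × EuclideanSpace ℝ (Fin 3) => U k z.1 z.2 + W z.1 z.2) 2 μQ := fun k => (hu3 k).mono_exponent h23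
  have hul2 : MemLp (fun z : ℝ × EuclideanSpace ℝ (Fin 3) => Ul z.1 z.2 + W z.1 z.2) 2 μQ := hul3.mono_exponent h23
  have hmmem : ∀ k, MemLp (fun z : ℝ × EuclideanSpace ℝ (Fin 3) => mollify η (ε k) (U k) z.1 z.2) 2 μQ := fun k =>
    ((hsol k).cylinder_classes hWc hη (hε k) hMW).2.2.2
  have hconvU3 : Tendsto (fun k => eLpNorm ((fun z : ℝ × EuclideanSpace ℝ (Fin 3) => U k z.1 z.2) - fun z => Ul z.1 z.2) 3 μQ)
      atTop (𝓝 0) :=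
    tendsto_eLpNorm_three_of_tendsto_lintegral (μ := μQ)
      (f := fun (k : ℕ) (z : ℝ × EuclideanSpace ℝ (Fin 3)) => U k z.1 z.2 - Ul z.1 z.2) (hconv3 n)
  have hconvu3 : Tendsto (fun k => eLpNorm ((fun z : ℝ × EuclideanSpace ℝ (Fin 3) => U k z.1 z.2 + W z.1 z.2) -
      fun z => Ul z.1 z.2 + W z.1 z.2) 3 μQ) atTop (𝓝 0) := by
    refine hconvU3.congr fun k => ?_
    congr 1; funext z; simp only [Pi.sub_apply]; abel
  have hconvU : Tendsto (fun k => eLpNorm ((fun z : ℝ × EuclideanSpace ℝ (Fin 3) => U k z.1 z.2) - fun z => Ul z.1 z.2) 2 μQ)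
      atTop (𝓝 0) :=
    FunctionSpaces.tendsto_eLpNorm_two_of_tendsto_lintegral_sq (f := fun k => uncurry (U k)) (g := uncurry Ul) (hconv n)
  have hconvu : Tendsto (fun k => eLpNorm ((fun z : ℝ × EuclideanSpace ℝ (Fin 3) => U k z.1 z.2 + W z.1 z.2) -
      fun z => Ul z.1 z.2 + W z.1 z.2) 2 μQ) atTop (𝓝 0) := by
    refine hconvU.congr fun k => ?_
    congr 1; funext z; simp only [Pi.sub_apply]; abel
  have hconvm3 : Tendsto (fun k => eLpNorm ((fun z : ℝ × EuclideanSpace ℝ (Fin 3) => mollify η (ε k) (U k) z.1 z.2) -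
      fun z => Ul z.1 z.2) 3 μQ) atTop (𝓝 0) := hmoll a b R
  have hconvm : Tendsto (fun k => eLpNorm ((fun z : ℝ × EuclideanSpace ℝ (Fin 3) => mollify η (ε k) (U k) z.1 z.2) -
      fun z => Ul z.1 z.2) 2 μQ) atTop (𝓝 0) :=
    tendsto_eLpNorm_two_of_three (fun k => (hmmem k).1.sub hUl2.1) hconvm3
  -- the drifts `b_k = W + η_ε * U_k → Ul + W` in `L³`
  have hconvb3 : Tendsto (fun k => eLpNorm ((fun z : ℝ × EuclideanSpace ℝ (Fin 3) => W z.1 z.2 + mollify η (ε k) (U k) z.1 z.2) -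
      fun z => Ul z.1 z.2 + W z.1 z.2) 3 μQ) atTop (𝓝 0) := by
    refine hconvm3.congr fun k => ?_
    congr 1; funext z; simp only [Pi.sub_apply]; abel
  -- `η_ε * U_k ∈ L³` eventually
  have hm3ev : ∀ᶠ k in atTop, MemLp (fun z : ℝ × EuclideanSpace ℝ (Fin 3) => mollify η (ε k) (U k) z.1 z.2) 3 μQ := by
    have h := eventually_eLpNorm_lt_top_of_tendsto (μ := μQ) h13 (fun k => (hmmem k).1) hUl3.1 hUl3.2 hconvm3
    filter_upwards [h] with k hk
    exact ⟨(hmmem k).1, hk⟩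
  -- the commutator `U_k − η_ε * U_k → 0` in `L²`
  have hconvc : Tendsto (fun k => eLpNorm ((fun z : ℝ × EuclideanSpace ℝ (Fin 3) => U k z.1 z.2 - mollify η (ε k) (U k) z.1 z.2) -
      fun _ => (0 : EuclideanSpace ℝ (Fin 3))) 2 μQ) atTop (𝓝 0) := by
    have hbd : ∀ k, eLpNorm ((fun z : ℝ × EuclideanSpace ℝ (Fin 3) => U k z.1 z.2 - mollify η (ε k) (U k) z.1 z.2) -
        fun _ => (0 : EuclideanSpace ℝ (Fin 3))) 2 μQ ≤
        eLpNorm ((fun z : ℝ × EuclideanSpace ℝ (Fin 3) => U k z.1 z.2) - fun z => Ul z.1 z.2) 2 μQ +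
          eLpNorm ((fun z : ℝ × EuclideanSpace ℝ (Fin 3) => mollify η (ε k) (U k) z.1 z.2) - fun z => Ul z.1 z.2) 2 μQ := by
      intro k
      have e : ((fun z : ℝ × EuclideanSpace ℝ (Fin 3) => U k z.1 z.2 - mollify η (ε k) (U k) z.1 z.2) - fun _ => (0 : EuclideanSpace ℝ (Fin 3))) =
          ((fun z : ℝ × EuclideanSpace ℝ (Fin 3) => U k z.1 z.2) - fun z => Ul z.1 z.2) -
            ((fun z : ℝ × EuclideanSpace ℝ (Fin 3) => mollify η (ε k) (U k) z.1 z.2) - fun z => Ul z.1 z.2) := by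
        funext z; simp only [Pi.sub_apply, sub_zero]; abel
      rw [e]
      exact eLpNorm_sub_le (((hU2 k).1.sub hUl2.1)) (((hmmem k).1.sub hUl2.1)) one_le_two
    have hlim : Tendsto (fun k => eLpNorm ((fun z : ℝ × EuclideanSpace ℝ (Fin 3) => U k z.1 z.2) - fun z => Ul z.1 z.2) 2 μQ +
        eLpNorm ((fun z : ℝ × EuclideanSpace ℝ (Fin 3) => mollify η (ε k) (U k) z.1 z.2) - fun z => Ul z.1 z.2) 2 μQ) atTop (𝓝 0) := by
      simpa using hconvU.add hconvm
    exact tendsto_of_tendsto_of_tendsto_of_le_of_le tendsto_const_nhds hlim (fun _ => zero_le) hbd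
  -- ## the pressures on the cylinder
  have hπm : ∀ k, AEStronglyMeasurable (fun z : ℝ × EuclideanSpace ℝ (Fin 3) => p k z.1 z.2) μQ := fun k =>
    (hsol k).aestronglyMeasurable_pressure.restrict
  have hCp := cylinderPressureBound_ne_top T C a b (0 : EuclideanSpace ℝ (Fin 3)) R
  have hπmem : ∀ k, MemLp (fun z : ℝ × EuclideanSpace ℝ (Fin 3) => p k z.1 z.2) (3 / 2) μQ ∧
      eLpNorm (fun z : ℝ × EuclideanSpace ℝ (Fin 3) => p k z.1 z.2) (3 / 2) μQ ≤
        (volume (Ioo a b ×ˢ ball (0 : EuclideanSpace ℝ (Fin 3)) R) ^ (1 / 10 : ℝ) *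
          (2 * (⌈(b - a) / T⌉₊ + 1 : ℕ) * (C : ℝ≥0∞)) ^ (9 / 10 : ℝ)) ^ (1 / (3 / 2 : ℝ)) := fun k =>
    memLp_threeHalves_of_lintegral_le (hπm k) hCp ((hsol k).lintegral_cylinder_pressure_le hT a b 0 R)
  have hplmem : MemLp (fun z : ℝ × EuclideanSpace ℝ (Fin 3) => pl z.1 z.2) (3 / 2) μQ := by
    have hm : AEMeasurable (fun z : ℝ × EuclideanSpace ℝ (Fin 3) => ‖pl z.1 z.2‖ₑ) μQ := hplm.restrict.enorm
    have hle := lintegral_rpow_threeHalves_le_of_fiveThirds _ hm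
    have hfin : ∫⁻ z, ‖pl z.1 z.2‖ₑ ^ (3 / 2 : ℝ) ∂μQ < ∞ := by
      exact hle.trans_lt (ENNReal.mul_lt_top (ENNReal.rpow_lt_top_of_nonneg (by norm_num) (measure_ne_top μQ _))
        (ENNReal.rpow_lt_top_of_nonneg (by norm_num) ((lintegral_mono_set hSslab).trans_lt (hpl53 a b)).ne))
    exact (memLp_threeHalves_of_lintegral_le hplm.restrict hfin.ne le_rfl).1
  have hpwQ : ∀ h : ℝ × EuclideanSpace ℝ (Fin 3) → ℝ, MemLp h 3 μQ →
      Tendsto (fun k => ∫ z, p k z.1 z.2 * h z ∂μQ) atTop (𝓝 (∫ z, pl z.1 z.2 * h z ∂μQ)) :=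
    fun h hh => hpw a b R h (hh.mono_exponent fiveHalves_le_three)
  -- ## the gradients on the cylinder
  have hGm : ∀ k, AEStronglyMeasurable (fun z : ℝ × EuclideanSpace ℝ (Fin 3) => G k z.1 z.2)
      (volume : Measure (ℝ × EuclideanSpace ℝ (Fin 3))) := by
    intro k
    have h1 := (hGg k).locallyIntegrableOn_grad.aestronglyMeasurable
    rwa [Opens.coe_top, Measure.restrict_univ] at h1
  have hGum : AEStronglyMeasurable (fun z : ℝ × EuclideanSpace ℝ (Fin 3) => Gu z.1 z.2)
      (volume : Measure (ℝ × EuclideanSpace ℝ (Fin 3))) := by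
    have h1 := hGu.locallyIntegrableOn_grad.aestronglyMeasurable
    rwa [Opens.coe_top, Measure.restrict_univ] at h1
  have hcolm : ∀ {Γ : ℝ × EuclideanSpace ℝ (Fin 3) → EuclideanSpace ℝ (Fin 3) →L[ℝ] EuclideanSpace ℝ (Fin 3)},
      AEStronglyMeasurable Γ μQ → ∀ a' : EuclideanSpace ℝ (Fin 3), AEStronglyMeasurable (fun z => Γ z a') μQ := fun hΓ a' =>
    happ.comp_aestronglyMeasurable₂ hΓ aestronglyMeasurable_const
  have hcol2 : ∀ {Γ : ℝ × EuclideanSpace ℝ (Fin 3) → EuclideanSpace ℝ (Fin 3) →L[ℝ] EuclideanSpace ℝ (Fin 3)}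
      {S' : Set (ℝ × EuclideanSpace ℝ (Fin 3))}, S ⊆ S' → ∀ i,
      eLpNorm (fun z => Γ z (stdOrthonormalBasis ℝ (EuclideanSpace ℝ (Fin 3)) i)) 2 μQ ≤
        (∫⁻ z in S', ENNReal.ofReal (frobeniusNormSq (Γ z))) ^ (1 / 2 : ℝ) := by
    intro Γ S' hSS' i
    rw [FunctionSpaces.AubinLions.eLpNorm_two_eq_rpow]
    refine ENNReal.rpow_le_rpow ((lintegral_mono fun z => ?_).trans (lintegral_mono_set hSS')) (by norm_num)
    rw [← ofReal_norm, ← ENNReal.ofReal_pow (norm_nonneg _)]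
    exact ENNReal.ofReal_le_ofReal (norm_apply_basis_sq_le_frobeniusNormSq _ _)
  have hGkmem : ∀ k i, MemLp (fun z : ℝ × EuclideanSpace ℝ (Fin 3) => G k z.1 z.2 (stdOrthonormalBasis ℝ (EuclideanSpace ℝ (Fin 3)) i)) 2 μQ := by
    intro k i
    refine ⟨hcolm (hGm k).restrict _, (hcol2 (Γ := fun z => G k z.1 z.2) hSslab i).trans_lt ?_⟩
    refine ENNReal.rpow_lt_top_of_nonneg (by norm_num) (lt_of_le_of_lt
      (lintegral_window_gradient_le (hGg k) hT (hsol k).periodic (hGb k) _ _) ?_).ne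
    exact ENNReal.mul_lt_top (ENNReal.mul_lt_top ENNReal.ofNat_lt_top (ENNReal.natCast_lt_top _)) ENNReal.coe_lt_top
  have hGumem : ∀ i, MemLp (fun z : ℝ × EuclideanSpace ℝ (Fin 3) => Gu z.1 z.2 (stdOrthonormalBasis ℝ (EuclideanSpace ℝ (Fin 3)) i)) 2 μQ :=
    fun i => ⟨hcolm hGum.restrict _, (hcol2 (Γ := fun z => Gu z.1 z.2) hSslab i).trans_lt
      (ENNReal.rpow_lt_top_of_nonneg (by norm_num) (hGub n).ne)⟩
  have hLcol : ∀ i, MemLp (fun z : ℝ × EuclideanSpace ℝ (Fin 3) => L z (stdOrthonormalBasis ℝ (EuclideanSpace ℝ (Fin 3)) i)) 2 μQ := by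
    intro i
    refine (memLp_top_of_bound (hcolm hLm _) MD (Eventually.of_forall fun z => ?_)).mono_exponent le_top
    refine ((L z).le_opNorm _).trans ?_
    rw [(stdOrthonormalBasis ℝ (EuclideanSpace ℝ (Fin 3))).orthonormal.1 i, mul_one]
    exact hLM z
  -- weak convergence of the columns on the cylinder
  have hGwQ : ∀ (a' : EuclideanSpace ℝ (Fin 3)) (h : ℝ × EuclideanSpace ℝ (Fin 3) → EuclideanSpace ℝ (Fin 3)), MemLp h 2 μQ →
      Tendsto (fun k => ∫ z, ⟪G k z.1 z.2 a', h z⟫ ∂μQ) atTop (𝓝 (∫ z, ⟪Gu z.1 z.2 a', h z⟫ ∂μQ)) := by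
    intro a' h hh
    set S' : Set (ℝ × EuclideanSpace ℝ (Fin 3)) := Ioo (-((n : ℝ) + 1)) ((n : ℝ) + 1) ×ˢ (univ : Set (EuclideanSpace ℝ (Fin 3))) with hS'
    have hres : (volume.restrict S').restrict S = μQ := by
      rw [Measure.restrict_restrict hSm, inter_eq_left.2 hSslab]
    have hh' : MemLp (S.indicator h) 2 (volume.restrict S') := by
      rw [memLp_indicator_iff_restrict hSm, hres]; exact hh
    have hind : ∀ (Γ : ℝ × EuclideanSpace ℝ (Fin 3) → EuclideanSpace ℝ (Fin 3) →L[ℝ] EuclideanSpace ℝ (Fin 3)),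
        ∫ z in S', ⟪Γ z a', S.indicator h z⟫ = ∫ z, ⟪Γ z a', h z⟫ ∂μQ := by
      intro Γ
      have h1 : (fun z => ⟪Γ z a', S.indicator h z⟫) = S.indicator fun z => ⟪Γ z a', h z⟫ := by
        funext z
        by_cases hz : z ∈ S
        · rw [indicator_of_mem hz, indicator_of_mem hz]
        · rw [indicator_of_notMem hz, indicator_of_notMem hz, inner_zero_right]
      rw [h1, setIntegral_indicator hSm, inter_eq_right.2 hSslab]
    have h := hGw n a' (S.indicator h) hh'
    rw [← hS'] at h
    simp only [hind] at h
    exact h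
  -- weak convergence of `G_k + L` (the gradients of `u_k` on the cylinder)
  have hGLw : ∀ (a' : EuclideanSpace ℝ (Fin 3)) (h : ℝ × EuclideanSpace ℝ (Fin 3) → EuclideanSpace ℝ (Fin 3)), MemLp h 2 μQ →
      Tendsto (fun k => ∫ z, ⟪(G k z.1 z.2 + L z) a', h z⟫ ∂μQ) atTop (𝓝 (∫ z, ⟪(Gu z.1 z.2 + L z) a', h z⟫ ∂μQ)) := by
    intro a' h hh
    have hint : ∀ {g : ℝ × EuclideanSpace ℝ (Fin 3) → EuclideanSpace ℝ (Fin 3)}, AEStronglyMeasurable g μQ → eLpNorm g 2 μQ < ⊤ →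
        Integrable (fun z => ⟪g z, h z⟫) μQ := fun {g} hgm hg2 =>
      ((MemLp.norm ⟨hgm, hg2⟩).integrable_mul hh.norm).mono' (hgm.inner hh.1) (Eventually.of_forall fun z => norm_inner_le_norm _ _)
    have hGa : ∀ k, MemLp (fun z : ℝ × EuclideanSpace ℝ (Fin 3) => G k z.1 z.2 a') 2 μQ := by
      intro k
      have e : (fun z : ℝ × EuclideanSpace ℝ (Fin 3) => G k z.1 z.2 a') =
          fun z => ∑ i, ⟪stdOrthonormalBasis ℝ (EuclideanSpace ℝ (Fin 3)) i, a'⟫ • G k z.1 z.2 (stdOrthonormalBasis ℝ (EuclideanSpace ℝ (Fin 3)) i) := by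
        funext z
        conv_lhs => rw [← (stdOrthonormalBasis ℝ (EuclideanSpace ℝ (Fin 3))).sum_repr' a']
        simp only [map_sum, map_smul]
      rw [e]
      refine memLp_finsetSum _ fun i _ => ?_
      exact ((hGkmem k i).const_smul ⟪stdOrthonormalBasis ℝ (EuclideanSpace ℝ (Fin 3)) i, a'⟫ :
        MemLp (fun z : ℝ × EuclideanSpace ℝ (Fin 3) => ⟪stdOrthonormalBasis ℝ (EuclideanSpace ℝ (Fin 3)) i, a'⟫ •
          G k z.1 z.2 (stdOrthonormalBasis ℝ (EuclideanSpace ℝ (Fin 3)) i)) 2 μQ)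
    have hGua : MemLp (fun z : ℝ × EuclideanSpace ℝ (Fin 3) => Gu z.1 z.2 a') 2 μQ := by
      have e : (fun z : ℝ × EuclideanSpace ℝ (Fin 3) => Gu z.1 z.2 a') =
          fun z => ∑ i, ⟪stdOrthonormalBasis ℝ (EuclideanSpace ℝ (Fin 3)) i, a'⟫ • Gu z.1 z.2 (stdOrthonormalBasis ℝ (EuclideanSpace ℝ (Fin 3)) i) := by
        funext z
        conv_lhs => rw [← (stdOrthonormalBasis ℝ (EuclideanSpace ℝ (Fin 3))).sum_repr' a']
        simp only [map_sum, map_smul]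
      rw [e]
      refine memLp_finsetSum _ fun i _ => ?_
      exact ((hGumem i).const_smul ⟪stdOrthonormalBasis ℝ (EuclideanSpace ℝ (Fin 3)) i, a'⟫ :
        MemLp (fun z : ℝ × EuclideanSpace ℝ (Fin 3) => ⟪stdOrthonormalBasis ℝ (EuclideanSpace ℝ (Fin 3)) i, a'⟫ •
          Gu z.1 z.2 (stdOrthonormalBasis ℝ (EuclideanSpace ℝ (Fin 3)) i)) 2 μQ)
    have hLa : MemLp (fun z : ℝ × EuclideanSpace ℝ (Fin 3) => L z a') 2 μQ :=
      (memLp_top_of_bound (hcolm hLm _) (MD * ‖a'‖) (Eventually.of_forall fun z =>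
        ((L z).le_opNorm _).trans (mul_le_mul_of_nonneg_right (hLM z) (norm_nonneg _)))).mono_exponent le_top
    have e : ∀ (Γ : ℝ × EuclideanSpace ℝ (Fin 3) → EuclideanSpace ℝ (Fin 3) →L[ℝ] EuclideanSpace ℝ (Fin 3)),
        MemLp (fun z => Γ z a') 2 μQ →
        ∫ z, ⟪(Γ z + L z) a', h z⟫ ∂μQ = (∫ z, ⟪Γ z a', h z⟫ ∂μQ) + ∫ z, ⟪L z a', h z⟫ ∂μQ := by
      intro Γ hΓ
      rw [← integral_add (hint hΓ.1 hΓ.2) (hint hLa.1 hLa.2)]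
      refine integral_congr_ae (Eventually.of_forall fun z => ?_)
      show ⟪(Γ z + L z) a', h z⟫ = ⟪Γ z a', h z⟫ + ⟪L z a', h z⟫
      rw [_root_.add_apply, inner_add_left]
    have e2 : (fun k => ∫ z, ⟪(G k z.1 z.2 + L z) a', h z⟫ ∂μQ) =
        fun k => (∫ z, ⟪G k z.1 z.2 a', h z⟫ ∂μQ) + ∫ z, ⟪L z a', h z⟫ ∂μQ :=
      funext fun k => e (fun z : ℝ × EuclideanSpace ℝ (Fin 3) => G k z.1 z.2) (hGa k)
    rw [e2, e (fun z : ℝ × EuclideanSpace ℝ (Fin 3) => Gu z.1 z.2) hGua]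
    exact (hGwQ a' h hh).add tendsto_const_nhds
  -- ## generic integrability facts on the cylinder
  have hy3 : MemLp (fun z : ℝ × EuclideanSpace ℝ (Fin 3) => z.2) 3 μQ := by
    refine (memLp_top_of_bound continuous_snd.aestronglyMeasurable.restrict R ?_).mono_exponent le_top
    filter_upwards [ae_restrict_mem hSm] with z hz
    exact (mem_ball_zero_iff.1 hz.2).le
  have hinner3 : ∀ {v : ℝ × EuclideanSpace ℝ (Fin 3) → EuclideanSpace ℝ (Fin 3)}, MemLp v 3 μQ →
      MemLp (fun z => ⟪v z, gradient (ψ z.1) z.2⟫) 3 μQ := by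
    intro v hv
    refine ⟨hv.1.inner hgm, ?_⟩
    have hle : eLpNorm (fun z => ⟪v z, gradient (ψ z.1) z.2⟫) 3 μQ ≤ ENNReal.ofReal Cψ * eLpNorm v 3 μQ :=
      eLpNorm_le_mul_eLpNorm_of_ae_le_mul (Eventually.of_forall fun z => by
        rw [mul_comm]
        exact (norm_inner_le_norm _ _).trans (mul_le_mul_of_nonneg_left (hgC z) (norm_nonneg _))) 3
    exact hle.trans_lt (ENNReal.mul_lt_top ENNReal.ofReal_lt_top hv.2)
  have hsq32 : ∀ {v : ℝ × EuclideanSpace ℝ (Fin 3) → EuclideanSpace ℝ (Fin 3)}, MemLp v 3 μQ →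
      MemLp (fun z => ‖v z‖ ^ 2) (3 / 2) μQ := fun {v} hv =>
    ⟨(hv.1.norm.aemeasurable.pow_const 2).aestronglyMeasurable,
      (eLpNorm_norm_sq_threeHalves_le hv.1).trans_lt (ENNReal.mul_lt_top hv.2 hv.2)⟩
  have hsq1 : ∀ {v : ℝ × EuclideanSpace ℝ (Fin 3) → EuclideanSpace ℝ (Fin 3)}, MemLp v 2 μQ →
      Integrable (fun z => ‖v z‖ ^ 2) μQ := fun {v} hv => (memLp_two_iff_integrable_sq_norm hv.1).1 hv
  have hinner : ∀ {v c : ℝ × EuclideanSpace ℝ (Fin 3) → EuclideanSpace ℝ (Fin 3)}, MemLp v 2 μQ → MemLp c 2 μQ →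
      Integrable (fun z => ⟪v z, c z⟫) μQ := fun {v c} hv hc =>
    (hv.norm.integrable_mul hc.norm).mono' (hv.1.inner hc.1) (Eventually.of_forall fun z => norm_inner_le_norm _ _)
  have hfrobInt : ∀ {Γ : ℝ × EuclideanSpace ℝ (Fin 3) → EuclideanSpace ℝ (Fin 3) →L[ℝ] EuclideanSpace ℝ (Fin 3)},
      (∀ i, MemLp (fun z => Γ z (stdOrthonormalBasis ℝ (EuclideanSpace ℝ (Fin 3)) i)) 2 μQ) →
      Integrable (fun z => frobeniusNormSq (Γ z)) μQ := by
    intro Γ hΓ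
    have e : (fun z => frobeniusNormSq (Γ z)) = fun z => ∑ i, ‖Γ z (stdOrthonormalBasis ℝ (EuclideanSpace ℝ (Fin 3)) i)‖ ^ 2 := rfl
    rw [e]
    exact integrable_finsetSum _ fun i _ => hsq1 (hΓ i)
  -- the weighted profile derivative `ψ • L`
  set Lψ : ℝ × EuclideanSpace ℝ (Fin 3) → EuclideanSpace ℝ (Fin 3) →L[ℝ] EuclideanSpace ℝ (Fin 3) :=
    fun z => ψ z.1 z.2 • L z with hLψ
  have hLψm : AEStronglyMeasurable Lψ μQ := hψm.smul hLm
  have hLψC : ∀ z, ‖Lψ z‖ ≤ Cψ * MD := fun z => by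
    rw [hLψ]
    exact (norm_smul_le (ψ z.1 z.2) (L z)).trans (mul_le_mul (hψC z) (hLM z) (norm_nonneg _) hC0)
  have hLψmem : ∀ {v : ℝ × EuclideanSpace ℝ (Fin 3) → EuclideanSpace ℝ (Fin 3)}, MemLp v 2 μQ → MemLp (fun z => Lψ z (v z)) 2 μQ :=
    fun {v} hv => MemLp.of_le_mul (c := Cψ * MD) hv (happ.comp_aestronglyMeasurable₂ hLψm hv.1)
      (Eventually.of_forall fun z => (ContinuousLinearMap.le_opNorm _ _).trans (mul_le_mul_of_nonneg_right (hLψC z) (norm_nonneg _)))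
  -- ## the left-hand side: `∫ (‖u‖²/2 + |Γ|²) ψ = ∫ ‖u‖² (ψ/2) + ∫ |Γ|² ψ`
  have hψ2m : AEStronglyMeasurable (fun z : ℝ × EuclideanSpace ℝ (Fin 3) => ψ z.1 z.2 / 2) μQ :=
    (hψ.contDiff.continuous.div_const (2 : ℝ)).aestronglyMeasurable.restrict
  have hψ2C : ∀ z : ℝ × EuclideanSpace ℝ (Fin 3), ‖ψ z.1 z.2 / 2‖ ≤ Cψ := fun z => by
    rw [norm_div, Real.norm_ofNat]
    linarith [hψC z, norm_nonneg (ψ z.1 z.2)]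
  have hsplitL : ∀ {uf : ℝ × EuclideanSpace ℝ (Fin 3) → EuclideanSpace ℝ (Fin 3)}
      {Γ : ℝ × EuclideanSpace ℝ (Fin 3) → EuclideanSpace ℝ (Fin 3) →L[ℝ] EuclideanSpace ℝ (Fin 3)},
      MemLp uf 2 μQ → (∀ i, MemLp (fun z => Γ z (stdOrthonormalBasis ℝ (EuclideanSpace ℝ (Fin 3)) i)) 2 μQ) →
      Integrable (fun z => (‖uf z‖ ^ 2 / 2 + frobeniusNormSq (Γ z)) * ψ z.1 z.2) μQ ∧
      Integrable (fun z => frobeniusNormSq (Γ z) * ψ z.1 z.2) μQ ∧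
      ∫ z, (‖uf z‖ ^ 2 / 2 + frobeniusNormSq (Γ z)) * ψ z.1 z.2 ∂μQ =
        (∫ z, ‖uf z‖ ^ 2 * (ψ z.1 z.2 / 2) ∂μQ) + ∫ z, frobeniusNormSq (Γ z) * ψ z.1 z.2 ∂μQ := by
    intro uf Γ huf hΓ
    have iK : Integrable (fun z => ‖uf z‖ ^ 2 * (ψ z.1 z.2 / 2)) μQ :=
      ((hsq1 huf).bdd_mul hψ2m (Eventually.of_forall hψ2C)).congr (Eventually.of_forall fun z => mul_comm _ _)
    have iD : Integrable (fun z => frobeniusNormSq (Γ z) * ψ z.1 z.2) μQ :=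
      ((hfrobInt hΓ).bdd_mul hψm (Eventually.of_forall hψC)).congr (Eventually.of_forall fun z => mul_comm _ _)
    have e : (fun z => (‖uf z‖ ^ 2 / 2 + frobeniusNormSq (Γ z)) * ψ z.1 z.2) =
        fun z => ‖uf z‖ ^ 2 * (ψ z.1 z.2 / 2) + frobeniusNormSq (Γ z) * ψ z.1 z.2 := by
      funext z; ring
    rw [e]
    exact ⟨iK.add iD, iD, integral_add iK iD⟩
  -- ## the right-hand side: three pieces (and the commutator piece)
  have hwm : AEStronglyMeasurable (fun z : ℝ × EuclideanSpace ℝ (Fin 3) => (timeDeriv ψ z.1 z.2 + Δ (ψ z.1) z.2) / 2) μQ :=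
    ((hψ.continuous_timeDeriv.add hψ.continuous_laplacian_slice).div_const (2 : ℝ)).aestronglyMeasurable.restrict
  have hwC : ∀ z : ℝ × EuclideanSpace ℝ (Fin 3), ‖(timeDeriv ψ z.1 z.2 + Δ (ψ z.1) z.2) / 2‖ ≤ Cψ := fun z => by
    rw [norm_div, Real.norm_ofNat]
    linarith [norm_add_le (timeDeriv ψ z.1 z.2) (Δ (ψ z.1) z.2), htC z, hΔC z]
  have hsplitR : ∀ {uf b' : ℝ × EuclideanSpace ℝ (Fin 3) → EuclideanSpace ℝ (Fin 3)} {q : ℝ × EuclideanSpace ℝ (Fin 3) → ℝ},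
      MemLp uf 3 μQ → MemLp b' 3 μQ → MemLp q (3 / 2) μQ →
      Integrable (fun z => ‖uf z‖ ^ 2 / 2 * (timeDeriv ψ z.1 z.2 + Δ (ψ z.1) z.2) +
        (‖uf z‖ ^ 2 / 2 * ⟪b' z - z.2, gradient (ψ z.1) z.2⟫ + q z * ⟪uf z, gradient (ψ z.1) z.2⟫)) μQ ∧
      ∫ z, (‖uf z‖ ^ 2 / 2 * (timeDeriv ψ z.1 z.2 + Δ (ψ z.1) z.2) +
        (‖uf z‖ ^ 2 / 2 * ⟪b' z - z.2, gradient (ψ z.1) z.2⟫ + q z * ⟪uf z, gradient (ψ z.1) z.2⟫)) ∂μQ =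
        (∫ z, ‖uf z‖ ^ 2 * ((timeDeriv ψ z.1 z.2 + Δ (ψ z.1) z.2) / 2) ∂μQ) +
          ((∫ z, (1 / 2 : ℝ) * (‖uf z‖ ^ 2 * ⟪b' z - z.2, gradient (ψ z.1) z.2⟫) ∂μQ) +
            ∫ z, q z * ⟪uf z, gradient (ψ z.1) z.2⟫ ∂μQ) := by
    intro uf b' q huf hb' hq
    have huf2 : MemLp uf 2 μQ := huf.mono_exponent h23
    have i1 : Integrable (fun z => ‖uf z‖ ^ 2 * ((timeDeriv ψ z.1 z.2 + Δ (ψ z.1) z.2) / 2)) μQ :=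
      ((hsq1 huf2).bdd_mul hwm (Eventually.of_forall hwC)).congr (Eventually.of_forall fun z => mul_comm _ _)
    have hB : MemLp (fun z => ⟪b' z - z.2, gradient (ψ z.1) z.2⟫) 3 μQ := hinner3 (hb'.sub hy3)
    have i2' : Integrable (fun z => ‖uf z‖ ^ 2 * ⟪b' z - z.2, gradient (ψ z.1) z.2⟫) μQ := (hsq32 huf).integrable_mul hB
    have i2 : Integrable (fun z => (1 / 2 : ℝ) * (‖uf z‖ ^ 2 * ⟪b' z - z.2, gradient (ψ z.1) z.2⟫)) μQ := i2'.const_mul _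
    have i3 : Integrable (fun z => q z * ⟪uf z, gradient (ψ z.1) z.2⟫) μQ := hq.integrable_mul (hinner3 huf)
    have e : (fun z => ‖uf z‖ ^ 2 / 2 * (timeDeriv ψ z.1 z.2 + Δ (ψ z.1) z.2) +
        (‖uf z‖ ^ 2 / 2 * ⟪b' z - z.2, gradient (ψ z.1) z.2⟫ + q z * ⟪uf z, gradient (ψ z.1) z.2⟫)) =
        fun z => ‖uf z‖ ^ 2 * ((timeDeriv ψ z.1 z.2 + Δ (ψ z.1) z.2) / 2) +
          ((1 / 2 : ℝ) * (‖uf z‖ ^ 2 * ⟪b' z - z.2, gradient (ψ z.1) z.2⟫) + q z * ⟪uf z, gradient (ψ z.1) z.2⟫) := by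
      funext z; ring
    rw [e]
    have i23 : Integrable (fun z => (1 / 2 : ℝ) * (‖uf z‖ ^ 2 * ⟪b' z - z.2, gradient (ψ z.1) z.2⟫) +
        q z * ⟪uf z, gradient (ψ z.1) z.2⟫) μQ := i2.add i3
    refine ⟨i1.add i23, ?_⟩
    rw [integral_add i1 i23, integral_add i2 i3]
  have hcomm_int : ∀ {uf Uf mf : ℝ × EuclideanSpace ℝ (Fin 3) → EuclideanSpace ℝ (Fin 3)},
      MemLp uf 2 μQ → MemLp Uf 2 μQ → MemLp mf 2 μQ →
      Integrable (fun z => ⟪uf z, Lψ z (Uf z - mf z)⟫) μQ := fun {uf Uf mf} huf hUf hmf =>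
    hinner huf (hLψmem (hUf.sub hmf))
  -- ## the approximate local energy inequalities on the cylinder
  have hGLcol : ∀ k i, MemLp (fun z : ℝ × EuclideanSpace ℝ (Fin 3) =>
      (G k z.1 z.2 + L z) (stdOrthonormalBasis ℝ (EuclideanSpace ℝ (Fin 3)) i)) 2 μQ := fun k i =>
    ((hGkmem k i).add (hLcol i)).ae_eq (Eventually.of_forall fun z => by
      simp only [Pi.add_apply, _root_.add_apply])
  have hGuLcol : ∀ i, MemLp (fun z : ℝ × EuclideanSpace ℝ (Fin 3) =>
      (Gu z.1 z.2 + L z) (stdOrthonormalBasis ℝ (EuclideanSpace ℝ (Fin 3)) i)) 2 μQ := fun i =>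
    ((hGumem i).add (hLcol i)).ae_eq (Eventually.of_forall fun z => by
      simp only [Pi.add_apply, _root_.add_apply])
  have hvanL : ∀ (uf : ℝ × EuclideanSpace ℝ (Fin 3) → EuclideanSpace ℝ (Fin 3))
      (Γ : ℝ × EuclideanSpace ℝ (Fin 3) → EuclideanSpace ℝ (Fin 3) →L[ℝ] EuclideanSpace ℝ (Fin 3)) (z : ℝ × EuclideanSpace ℝ (Fin 3)),
      z ∉ S → (‖uf z‖ ^ 2 / 2 + frobeniusNormSq (Γ z)) * ψ z.1 z.2 = 0 := by
    intro uf Γ z hz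
    have h0 : ψ z.1 z.2 = 0 := image_eq_zero_of_notMem_tsupport (f := uncurry ψ) fun h => hz (hsuppS h)
    rw [h0, mul_zero]
  have hvanR : ∀ (uf b' : ℝ × EuclideanSpace ℝ (Fin 3) → EuclideanSpace ℝ (Fin 3)) (q c : ℝ × EuclideanSpace ℝ (Fin 3) → ℝ)
      (z : ℝ × EuclideanSpace ℝ (Fin 3)), z ∉ S →
      ‖uf z‖ ^ 2 / 2 * (timeDeriv ψ z.1 z.2 + Δ (ψ z.1) z.2) +
        (‖uf z‖ ^ 2 / 2 * ⟪b' z - z.2, gradient (ψ z.1) z.2⟫ + q z * ⟪uf z, gradient (ψ z.1) z.2⟫) - c z * ψ z.1 z.2 = 0 := by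
    intro uf b' q c z hz
    obtain ⟨h1, h2, h3, h4⟩ := weights_eq_zero_of_notMem_tsupport (φ := ψ) (fun h => hz (hsuppS h))
    rw [h1, h2, h3, h4, inner_zero_right, inner_zero_right]
    ring
  have hk : ∀ᶠ k in atTop,
      (∫ z, ‖U k z.1 z.2 + W z.1 z.2‖ ^ 2 * (ψ z.1 z.2 / 2) ∂μQ) + (∫ z, frobeniusNormSq (G k z.1 z.2 + L z) * ψ z.1 z.2 ∂μQ) ≤
      (∫ z, ‖U k z.1 z.2 + W z.1 z.2‖ ^ 2 * ((timeDeriv ψ z.1 z.2 + Δ (ψ z.1) z.2) / 2) ∂μQ) +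
        ((∫ z, (1 / 2 : ℝ) * (‖U k z.1 z.2 + W z.1 z.2‖ ^ 2 *
            ⟪(W z.1 z.2 + mollify η (ε k) (U k) z.1 z.2) - z.2, gradient (ψ z.1) z.2⟫) ∂μQ) +
          ∫ z, p k z.1 z.2 * ⟪U k z.1 z.2 + W z.1 z.2, gradient (ψ z.1) z.2⟫ ∂μQ) -
        ∫ z, ⟪U k z.1 z.2 + W z.1 z.2, Lψ z (U k z.1 z.2 - mollify η (ε k) (U k) z.1 z.2)⟫ ∂μQ := by
    filter_upwards [hm3ev] with k hk3
    obtain ⟨hLi, -, hLe⟩ := hsplitL (uf := fun z => U k z.1 z.2 + W z.1 z.2) (Γ := fun z => G k z.1 z.2 + L z) (hu2 k) (hGLcol k)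
    obtain ⟨hRi, hRe⟩ := hsplitR (uf := fun z => U k z.1 z.2 + W z.1 z.2)
      (b' := fun z => W z.1 z.2 + mollify η (ε k) (U k) z.1 z.2) (q := fun z => p k z.1 z.2) (hu3 k) (hWmem3.add hk3) (hπmem k).1
    have hci := hcomm_int (hu2 k) (hU2 k) (hmmem k)
    -- the original integrands agree with the `L`-versions a.e. on the cylinder
    have haeL : (fun z : ℝ × EuclideanSpace ℝ (Fin 3) => (‖U k z.1 z.2 + W z.1 z.2‖ ^ 2 / 2 +
        frobeniusNormSq (G k z.1 z.2 + fderiv ℝ (W z.1) z.2)) * ψ z.1 z.2) =ᵐ[μQ]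
        fun z => (‖U k z.1 z.2 + W z.1 z.2‖ ^ 2 / 2 + frobeniusNormSq (G k z.1 z.2 + L z)) * ψ z.1 z.2 := by
      filter_upwards [hLae] with z hz
      rw [hz]
    have haeR : (fun z : ℝ × EuclideanSpace ℝ (Fin 3) => ‖U k z.1 z.2 + W z.1 z.2‖ ^ 2 / 2 * (timeDeriv ψ z.1 z.2 + Δ (ψ z.1) z.2) +
        (‖U k z.1 z.2 + W z.1 z.2‖ ^ 2 / 2 * ⟪W z.1 z.2 + mollify η (ε k) (U k) z.1 z.2 - z.2, gradient (ψ z.1) z.2⟫ +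
          p k z.1 z.2 * ⟪U k z.1 z.2 + W z.1 z.2, gradient (ψ z.1) z.2⟫) -
        ⟪fderiv ℝ (W z.1) z.2 (U k z.1 z.2 - mollify η (ε k) (U k) z.1 z.2), U k z.1 z.2 + W z.1 z.2⟫ * ψ z.1 z.2) =ᵐ[μQ]
        fun z => ‖U k z.1 z.2 + W z.1 z.2‖ ^ 2 / 2 * (timeDeriv ψ z.1 z.2 + Δ (ψ z.1) z.2) +
          (‖U k z.1 z.2 + W z.1 z.2‖ ^ 2 / 2 * ⟪W z.1 z.2 + mollify η (ε k) (U k) z.1 z.2 - z.2, gradient (ψ z.1) z.2⟫ +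
            p k z.1 z.2 * ⟪U k z.1 z.2 + W z.1 z.2, gradient (ψ z.1) z.2⟫) -
          ⟪U k z.1 z.2 + W z.1 z.2, Lψ z (U k z.1 z.2 - mollify η (ε k) (U k) z.1 z.2)⟫ := by
      filter_upwards [hLae] with z hz
      rw [← hz, hLψ]
      simp only [_root_.smul_apply, real_inner_smul_right, real_inner_comm (U k z.1 z.2 + W z.1 z.2)]
      ring
    -- iterated integrals → integrals over the cylinder
    have hIL : IntegrableOn (fun z : ℝ × EuclideanSpace ℝ (Fin 3) => (‖U k z.1 z.2 + W z.1 z.2‖ ^ 2 / 2 +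
        frobeniusNormSq (G k z.1 z.2 + fderiv ℝ (W z.1) z.2)) * ψ z.1 z.2) S volume := hLi.congr haeL.symm
    have hIR : IntegrableOn (fun z : ℝ × EuclideanSpace ℝ (Fin 3) => ‖U k z.1 z.2 + W z.1 z.2‖ ^ 2 / 2 * (timeDeriv ψ z.1 z.2 + Δ (ψ z.1) z.2) +
        (‖U k z.1 z.2 + W z.1 z.2‖ ^ 2 / 2 * ⟪W z.1 z.2 + mollify η (ε k) (U k) z.1 z.2 - z.2, gradient (ψ z.1) z.2⟫ +
          p k z.1 z.2 * ⟪U k z.1 z.2 + W z.1 z.2, gradient (ψ z.1) z.2⟫) -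
        ⟪fderiv ℝ (W z.1) z.2 (U k z.1 z.2 - mollify η (ε k) (U k) z.1 z.2), U k z.1 z.2 + W z.1 z.2⟫ * ψ z.1 z.2) S volume :=
      (hRi.sub hci).congr haeR.symm
    have eL := integral_integral_eq_setIntegral hIL (fun z hz => hvanL (fun z => U k z.1 z.2 + W z.1 z.2)
      (fun z => G k z.1 z.2 + fderiv ℝ (W z.1) z.2) z hz)
    have eR := integral_integral_eq_setIntegral hIR (fun z hz => hvanR (fun z => U k z.1 z.2 + W z.1 z.2)
      (fun z => W z.1 z.2 + mollify η (ε k) (U k) z.1 z.2) (fun z => p k z.1 z.2)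
      (fun z => ⟪fderiv ℝ (W z.1) z.2 (U k z.1 z.2 - mollify η (ε k) (U k) z.1 z.2), U k z.1 z.2 + W z.1 z.2⟫) z hz)
    have hineq := hGiv k ψ hψ hψ0
    rw [eL, eR, integral_congr_ae haeL, integral_congr_ae haeR, hLe, integral_sub hRi hci, hRe] at hineq
    exact hineq
  -- ## the limits of the pieces
  have hKlim : Tendsto (fun k => ∫ z, ‖U k z.1 z.2 + W z.1 z.2‖ ^ 2 * (ψ z.1 z.2 / 2) ∂μQ) atTop
      (𝓝 (∫ z, ‖Ul z.1 z.2 + W z.1 z.2‖ ^ 2 * (ψ z.1 z.2 / 2) ∂μQ)) :=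
    tendsto_integral_norm_sq_mul hu2 hul2 hconvu hψ2m hC0 hψ2C
  have hR1 : Tendsto (fun k => ∫ z, ‖U k z.1 z.2 + W z.1 z.2‖ ^ 2 * ((timeDeriv ψ z.1 z.2 + Δ (ψ z.1) z.2) / 2) ∂μQ) atTop
      (𝓝 (∫ z, ‖Ul z.1 z.2 + W z.1 z.2‖ ^ 2 * ((timeDeriv ψ z.1 z.2 + Δ (ψ z.1) z.2) / 2) ∂μQ)) :=
    tendsto_integral_norm_sq_mul hu2 hul2 hconvu hwm hC0 hwC
  have hR2 : Tendsto (fun k => ∫ z, (1 / 2 : ℝ) * (‖U k z.1 z.2 + W z.1 z.2‖ ^ 2 *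
      ⟪(W z.1 z.2 + mollify η (ε k) (U k) z.1 z.2) - z.2, gradient (ψ z.1) z.2⟫) ∂μQ) atTop
      (𝓝 (∫ z, (1 / 2 : ℝ) * (‖Ul z.1 z.2 + W z.1 z.2‖ ^ 2 * ⟪(Ul z.1 z.2 + W z.1 z.2) - z.2, gradient (ψ z.1) z.2⟫) ∂μQ)) := by
    have hA := tendsto_eLpNorm_norm_sq_sub (μ := μQ) (f := fun (k : ℕ) (z : ℝ × EuclideanSpace ℝ (Fin 3)) => U k z.1 z.2 + W z.1 z.2)
      (g := fun z : ℝ × EuclideanSpace ℝ (Fin 3) => Ul z.1 z.2 + W z.1 z.2) (fun k => (hu3 k).1) hul3 hconvu3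
    have hBm : ∀ k, AEStronglyMeasurable (fun z : ℝ × EuclideanSpace ℝ (Fin 3) =>
        ⟪(W z.1 z.2 + mollify η (ε k) (U k) z.1 z.2) - z.2, gradient (ψ z.1) z.2⟫) μQ := fun k =>
      ((hWm.add (hmmem k).1).sub continuous_snd.aestronglyMeasurable.restrict).inner hgm
    have hB'mem : MemLp (fun z : ℝ × EuclideanSpace ℝ (Fin 3) => ⟪(Ul z.1 z.2 + W z.1 z.2) - z.2, gradient (ψ z.1) z.2⟫) 3 μQ :=
      hinner3 (hul3.sub hy3)
    have hB : Tendsto (fun k => eLpNorm ((fun z : ℝ × EuclideanSpace ℝ (Fin 3) =>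
        ⟪(W z.1 z.2 + mollify η (ε k) (U k) z.1 z.2) - z.2, gradient (ψ z.1) z.2⟫) -
        fun z => ⟪(Ul z.1 z.2 + W z.1 z.2) - z.2, gradient (ψ z.1) z.2⟫) 3 μQ) atTop (𝓝 0) := by
      have hbd : ∀ k, eLpNorm ((fun z : ℝ × EuclideanSpace ℝ (Fin 3) =>
          ⟪(W z.1 z.2 + mollify η (ε k) (U k) z.1 z.2) - z.2, gradient (ψ z.1) z.2⟫) -
          fun z => ⟪(Ul z.1 z.2 + W z.1 z.2) - z.2, gradient (ψ z.1) z.2⟫) 3 μQ ≤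
          ENNReal.ofReal Cψ * eLpNorm ((fun z : ℝ × EuclideanSpace ℝ (Fin 3) => W z.1 z.2 + mollify η (ε k) (U k) z.1 z.2) -
            fun z => Ul z.1 z.2 + W z.1 z.2) 3 μQ := by
        intro k
        refine eLpNorm_le_mul_eLpNorm_of_ae_le_mul (Eventually.of_forall fun z => ?_) 3
        simp only [Pi.sub_apply, ← inner_sub_left, sub_sub_sub_cancel_right]
        rw [mul_comm]
        exact (norm_inner_le_norm _ _).trans (mul_le_mul_of_nonneg_left (hgC z) (norm_nonneg _))
      have h2 := ENNReal.Tendsto.const_mul (a := ENNReal.ofReal Cψ) hconvb3 (Or.inr ENNReal.ofReal_ne_top)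
      rw [mul_zero] at h2
      exact tendsto_of_tendsto_of_tendsto_of_le_of_le tendsto_const_nhds h2 (fun k => zero_le) hbd
    exact FunctionSpaces.tendsto_integral_mul_mul (μ := μQ)
      (A := fun (k : ℕ) (z : ℝ × EuclideanSpace ℝ (Fin 3)) => ‖U k z.1 z.2 + W z.1 z.2‖ ^ 2)
      (A' := fun z : ℝ × EuclideanSpace ℝ (Fin 3) => ‖Ul z.1 z.2 + W z.1 z.2‖ ^ 2)
      (B := fun (k : ℕ) (z : ℝ × EuclideanSpace ℝ (Fin 3)) => ⟪(W z.1 z.2 + mollify η (ε k) (U k) z.1 z.2) - z.2, gradient (ψ z.1) z.2⟫)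
      (B' := fun z : ℝ × EuclideanSpace ℝ (Fin 3) => ⟪(Ul z.1 z.2 + W z.1 z.2) - z.2, gradient (ψ z.1) z.2⟫)
      (fun k => (hsq32 (hu3 k)).1) (hsq32 hul3).1 hBm hB'mem.1 (hsq32 hul3).2 hB'mem.2 hA hB
      (c := fun _ => (1 / 2 : ℝ)) aestronglyMeasurable_const (C := 1 / 2) (fun _ => by norm_num)
  have hMt : (volume (Ioo a b ×ˢ ball (0 : EuclideanSpace ℝ (Fin 3)) R) ^ (1 / 10 : ℝ) *
      (2 * (⌈(b - a) / T⌉₊ + 1 : ℕ) * (C : ℝ≥0∞)) ^ (9 / 10 : ℝ)) ^ (1 / (3 / 2 : ℝ)) ≠ ⊤ :=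
    ENNReal.rpow_ne_top_of_nonneg (by norm_num) hCp
  have hR3 : Tendsto (fun k => ∫ z, p k z.1 z.2 * ⟪U k z.1 z.2 + W z.1 z.2, gradient (ψ z.1) z.2⟫ ∂μQ) atTop
      (𝓝 (∫ z, pl z.1 z.2 * ⟪Ul z.1 z.2 + W z.1 z.2, gradient (ψ z.1) z.2⟫ ∂μQ)) :=
    tendsto_integral_mul_inner_of_weak_strong (μ := μQ) (π := fun (k : ℕ) (z : ℝ × EuclideanSpace ℝ (Fin 3)) => p k z.1 z.2)
      (p := fun z : ℝ × EuclideanSpace ℝ (Fin 3) => pl z.1 z.2)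
      (f := fun (k : ℕ) (z : ℝ × EuclideanSpace ℝ (Fin 3)) => U k z.1 z.2 + W z.1 z.2)
      (g := fun z : ℝ × EuclideanSpace ℝ (Fin 3) => Ul z.1 z.2 + W z.1 z.2)
      hMt hπm (fun k => (hπmem k).2) hpwQ hu3 hul3 hconvu3 hgm hgC
  have hR4 : Tendsto (fun k => ∫ z, ⟪U k z.1 z.2 + W z.1 z.2, Lψ z (U k z.1 z.2 - mollify η (ε k) (U k) z.1 z.2)⟫ ∂μQ) atTop
      (𝓝 0) := by
    have h := tendsto_integral_inner_clm_apply₂ (μ := μQ)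
      (f := fun (k : ℕ) (z : ℝ × EuclideanSpace ℝ (Fin 3)) => U k z.1 z.2 + W z.1 z.2)
      (f₀ := fun z : ℝ × EuclideanSpace ℝ (Fin 3) => Ul z.1 z.2 + W z.1 z.2)
      (g := fun (k : ℕ) (z : ℝ × EuclideanSpace ℝ (Fin 3)) => U k z.1 z.2 - mollify η (ε k) (U k) z.1 z.2)
      (g₀ := fun _ : ℝ × EuclideanSpace ℝ (Fin 3) => (0 : EuclideanSpace ℝ (Fin 3)))
      (L := Lψ) hu2 hul2 (fun k => (hU2 k).sub (hmmem k)) (MemLp.zero' ) hconvu hconvc hLψm (by positivity) hLψC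
    simpa only [map_zero, inner_zero_right, integral_zero] using h
  have hRlim := (hR1.add (hR2.add hR3)).sub hR4
  rw [sub_zero] at hRlim
  set Ru : ℝ := (∫ z, ‖Ul z.1 z.2 + W z.1 z.2‖ ^ 2 * ((timeDeriv ψ z.1 z.2 + Δ (ψ z.1) z.2) / 2) ∂μQ) +
    ((∫ z, (1 / 2 : ℝ) * (‖Ul z.1 z.2 + W z.1 z.2‖ ^ 2 * ⟪(Ul z.1 z.2 + W z.1 z.2) - z.2, gradient (ψ z.1) z.2⟫) ∂μQ) +
      ∫ z, pl z.1 z.2 * ⟪Ul z.1 z.2 + W z.1 z.2, gradient (ψ z.1) z.2⟫ ∂μQ) with hRu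
  set K : ℝ := ∫ z, ‖Ul z.1 z.2 + W z.1 z.2‖ ^ 2 * (ψ z.1 z.2 / 2) ∂μQ with hK
  -- ## weak lower semicontinuity of the dissipation
  obtain ⟨hLiI, hDiI, hLeI⟩ := hsplitL (uf := fun z => Ul z.1 z.2 + W z.1 z.2) (Γ := fun z => Gu z.1 z.2 + L z) hul2 hGuLcol
  set D : ℝ := ∫ z, frobeniusNormSq (Gu z.1 z.2 + L z) * ψ z.1 z.2 ∂μQ with hD
  have hGLm : ∀ k, AEStronglyMeasurable (fun z : ℝ × EuclideanSpace ℝ (Fin 3) => G k z.1 z.2 + L z) μQ :=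
    fun k => (hGm k).restrict.add hLm
  have hGuLm : AEStronglyMeasurable (fun z : ℝ × EuclideanSpace ℝ (Fin 3) => Gu z.1 z.2 + L z) μQ := hGum.restrict.add hLm
  have hGuL2 : ∫⁻ z, ENNReal.ofReal (frobeniusNormSq (Gu z.1 z.2 + L z)) ∂μQ < ∞ := by
    have hf := hfrobInt hGuLcol
    refine lt_of_le_of_lt (lintegral_mono fun z => ?_) hf.2
    exact Real.ofReal_le_enorm _
  have hmain : K + D ≤ Ru := by
    refine le_of_forall_pos_le_add fun δ hδ => ?_
    -- eventually `D_k ≤ (Ru - K) + δ`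
    have hdiff := hRlim.sub hKlim
    have hnonneg : ∀ k, 0 ≤ ∫ z, frobeniusNormSq (G k z.1 z.2 + L z) * ψ z.1 z.2 ∂μQ := fun k =>
      integral_nonneg fun z => mul_nonneg (frobeniusNormSq_nonneg _) (hψ0 _ _)
    have hΛ0 : 0 ≤ Ru - K := by
      refine ge_of_tendsto hdiff ?_
      filter_upwards [hk] with k hkk
      linarith [hnonneg k]
    set Bd : ℝ≥0∞ := ENNReal.ofReal (Ru - K + δ) with hBd
    have hev : ∀ᶠ k in atTop, ∫⁻ z, ENNReal.ofReal (frobeniusNormSq (G k z.1 z.2 + L z) * ψ z.1 z.2) ∂μQ ≤ Bd := by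
      have hlt : ∀ᶠ k in atTop, (fun k => (∫ z, ‖U k z.1 z.2 + W z.1 z.2‖ ^ 2 * ((timeDeriv ψ z.1 z.2 + Δ (ψ z.1) z.2) / 2) ∂μQ) +
          ((∫ z, (1 / 2 : ℝ) * (‖U k z.1 z.2 + W z.1 z.2‖ ^ 2 *
              ⟪(W z.1 z.2 + mollify η (ε k) (U k) z.1 z.2) - z.2, gradient (ψ z.1) z.2⟫) ∂μQ) +
            ∫ z, p k z.1 z.2 * ⟪U k z.1 z.2 + W z.1 z.2, gradient (ψ z.1) z.2⟫ ∂μQ) -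
          (∫ z, ⟪U k z.1 z.2 + W z.1 z.2, Lψ z (U k z.1 z.2 - mollify η (ε k) (U k) z.1 z.2)⟫ ∂μQ) -
          ∫ z, ‖U k z.1 z.2 + W z.1 z.2‖ ^ 2 * (ψ z.1 z.2 / 2) ∂μQ) k < Ru - K + δ :=
        (tendsto_order.1 hdiff).2 _ (lt_add_of_pos_right _ hδ)
      filter_upwards [hk, hlt] with k hkk hklt
      have hint : Integrable (fun z : ℝ × EuclideanSpace ℝ (Fin 3) => frobeniusNormSq (G k z.1 z.2 + L z) * ψ z.1 z.2) μQ :=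
        (hsplitL (uf := fun z => U k z.1 z.2 + W z.1 z.2) (Γ := fun z => G k z.1 z.2 + L z) (hu2 k) (hGLcol k)).2.1
      have hnn : 0 ≤ᵐ[μQ] fun z : ℝ × EuclideanSpace ℝ (Fin 3) => frobeniusNormSq (G k z.1 z.2 + L z) * ψ z.1 z.2 :=
        Eventually.of_forall fun z => mul_nonneg (frobeniusNormSq_nonneg _) (hψ0 _ _)
      rw [← ofReal_integral_eq_lintegral_ofReal hint hnn, hBd]
      refine ENNReal.ofReal_le_ofReal ?_
      linarith
    have hlsc := lintegral_frobeniusNormSq_mul_le_of_tendsto (μ := μQ)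
      (G := fun (k : ℕ) (z : ℝ × EuclideanSpace ℝ (Fin 3)) => G k z.1 z.2 + L z)
      (Gu := fun z : ℝ × EuclideanSpace ℝ (Fin 3) => Gu z.1 z.2 + L z)
      (φ := fun z : ℝ × EuclideanSpace ℝ (Fin 3) => ψ z.1 z.2) (C := Cψ) hGLm hGuLm hGuL2 hψm (fun z => hψ0 _ _)
      (fun z => (le_abs_self _).trans ((Real.norm_eq_abs _).symm.le.trans (hψC z))) hGLw hev
    have hnn : 0 ≤ᵐ[μQ] fun z : ℝ × EuclideanSpace ℝ (Fin 3) => frobeniusNormSq (Gu z.1 z.2 + L z) * ψ z.1 z.2 :=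
      Eventually.of_forall fun z => mul_nonneg (frobeniusNormSq_nonneg _) (hψ0 _ _)
    have e := ofReal_integral_eq_lintegral_ofReal hDiI hnn
    change ∫⁻ z, ENNReal.ofReal (frobeniusNormSq (Gu z.1 z.2 + L z) * ψ z.1 z.2) ∂μQ ≤ Bd at hlsc
    rw [← e, hBd, ENNReal.ofReal_le_ofReal_iff (by linarith)] at hlsc
    change D ≤ Ru - K + δ at hlsc
    linarith
  -- ## back to the iterated integrals of the statement
  have haeLI : (fun z : ℝ × EuclideanSpace ℝ (Fin 3) => (‖Ul z.1 z.2 + W z.1 z.2‖ ^ 2 / 2 +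
      frobeniusNormSq (Gu z.1 z.2 + fderiv ℝ (W z.1) z.2)) * ψ z.1 z.2) =ᵐ[μQ]
      fun z => (‖Ul z.1 z.2 + W z.1 z.2‖ ^ 2 / 2 + frobeniusNormSq (Gu z.1 z.2 + L z)) * ψ z.1 z.2 := by
    filter_upwards [hLae] with z hz
    rw [hz]
  have hILI : IntegrableOn (fun z : ℝ × EuclideanSpace ℝ (Fin 3) => (‖Ul z.1 z.2 + W z.1 z.2‖ ^ 2 / 2 +
      frobeniusNormSq (Gu z.1 z.2 + fderiv ℝ (W z.1) z.2)) * ψ z.1 z.2) S volume := hLiI.congr haeLI.symm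
  obtain ⟨hRiI, hReI⟩ := hsplitR (uf := fun z => Ul z.1 z.2 + W z.1 z.2) (b' := fun z => Ul z.1 z.2 + W z.1 z.2)
    (q := fun z => pl z.1 z.2) hul3 hul3 hplmem
  have eLI := integral_integral_eq_setIntegral hILI (fun z hz => hvanL (fun z => Ul z.1 z.2 + W z.1 z.2)
    (fun z => Gu z.1 z.2 + fderiv ℝ (W z.1) z.2) z hz)
  have eRI := integral_integral_eq_setIntegral hRiI (fun z hz => by
    have h := hvanR (fun z => Ul z.1 z.2 + W z.1 z.2) (fun z => Ul z.1 z.2 + W z.1 z.2) (fun z => pl z.1 z.2) (fun _ => 0) z hz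
    simpa only [zero_mul, sub_zero] using h)
  rw [eLI, eRI, integral_congr_ae haeLI, hLeI, hReI]
  exact hmain

end LocalEnergyLimit

end BradshawTsai2017

end Literature.Analysis.FluidPDE

end
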